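import Mathlib
import Summits.ValiantsHypothesis.ValiantsHypothesis.Theses.NewtonUnitEquations
import Summits.ValiantsHypothesis.ValiantsHypothesis.Theorems.NewtonUnitEquationsDissociatedFixedK

/-!
# `FrameRungTwo` — WITNESS / specialisation file (forward discipline F3, BC5)

Self-contained copy of the graded family `FrameRung` of `Lines/FrameRungTwo.lean` (character-identical
definition) and the proof that its one-frame member IS the proved floor
`Summit.ValiantsHypothesis.Theorems.dissociatedFixedK_proof` (seed g1-ValiantsHypothesis-5907).
No sorry.  Witness regime: fixed `k`, ONE common dissociated frame, budget `(m t + 2)^{C(k)}` — the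
KPTT Conjecture-1 regime restricted to frames; the Statement (`VP ≠ VNP`) is not known in ANY regime, and the
floor's bound is not implied by the route target `NewtonTauWeak` (budget `2^{a m}`), so the witness lies outside
everything the Statement side gives.
-/

set_option linter.dupNamespace false

namespace Summit.ValiantsHypothesis.ValiantsHypothesis.Cruxes.TwoProducts.FrameRungTwo.Special

open MvPolynomial
open scoped BigOperators

noncomputable section

/-- The route's embedding of exponent vectors into the real plane. -/
abbrev emb : (Fin 2 →₀ ℕ) → (Fin 2 → ℝ) := fun e i => ((e i : ℕ) : ℝ)

/-- The graded family (verbatim from `Lines/FrameRungTwo.lean`). -/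
def FrameRung (s : ℕ) : Prop :=
  ∀ k : ℕ, ∃ C : ℕ, ∀ (m t : ℕ) (A : Fin s → Fin m → Finset (Fin 2 →₀ ℕ)) (c : Fin k → Fin s)
    (f : Fin k → Fin m → MvPolynomial (Fin 2) ℂ),
    (∀ σ j, (A σ j).card ≤ t) →
    (∀ i j, (f i j).support ⊆ A (c i) j) →
    (∀ σ, ∀ a b : Fin m → (Fin 2 →₀ ℕ), (∀ j, a j ∈ A σ j) → (∀ j, b j ∈ A σ j) →
        ∑ j, a j = ∑ j, b j → a = b) →
    (Set.extremePoints ℝ (convexHull ℝ (emb '' ((∑ i, ∏ j, f i j).support : Set (Fin 2 →₀ ℕ))))).ncard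
      ≤ (m * t + 2) ^ C

/-- The rung. -/
def FrameRungTwo : Prop := FrameRung 2

/-- **F3 witness**: the floor `DissociatedFixedK` (proved: `dissociatedFixedK_proof`) is `FrameRung 1`. -/
example : FrameRung 1 := by
  intro k
  obtain ⟨C, hC⟩ := Summit.ValiantsHypothesis.Theorems.dissociatedFixedK_proof k
  exact ⟨C, fun m t A c f hA hf hinj =>
    hC m t (A 0) f (hA 0) (fun i j => by simpa [Subsingleton.elim (c i) 0] using hf i j) (hinj 0)⟩

/-- Named form of the witness (for `witness=` in the FORWARD block). -/
theorem frameRung_one_of_dissociatedFixedK : FrameRung 1 := by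
  intro k
  obtain ⟨C, hC⟩ := Summit.ValiantsHypothesis.Theorems.dissociatedFixedK_proof k
  refine ⟨C, fun m t A c f hA hf hinj => hC m t (A 0) f (hA 0) (fun i j => ?_) (hinj 0)⟩
  have h := hf i j
  rwa [Subsingleton.elim (c i) 0] at h

/-- Conversely the floor's statement is recovered from `FrameRung 1` (so `FrameRung 1 ↔ DissociatedFixedK`). -/
theorem dissociatedFixedK_of_frameRung_one (h : FrameRung 1) :
    Summit.ValiantsHypothesis.ValiantsHypothesis.Theses.NewtonUnitEquations.DissociatedFixedK := by
  intro k
  obtain ⟨C, hC⟩ := h k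
  exact ⟨C, fun m t A f hA hf hinj =>
    hC m t (fun _ => A) (fun _ => 0) f (fun _ j => hA j) (fun i j => hf i j) (fun _ => hinj)⟩

end

end Summit.ValiantsHypothesis.ValiantsHypothesis.Cruxes.TwoProducts.FrameRungTwo.Special
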